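import Summits.QuantumFields.YangMills.Theorems.BalabanUVNodesN15CovariantLandauLetterExp
import Summits.QuantumFields.YangMills.Theorems.BalabanUVNodesN15ExpLetters
import HarnessLib

/-!
# Route «BalabanUVNodes», node N15 = NE2, road (c) — PROGRAMME (P-S), XVII: THE LIPSCHITZ LETTER OF THE KNIT's TRANSPORTERS `T = coordMat e Ad_{e^{A/n}}` — `Σ_j|(T_μ(z) − T_μ(z − e_μ))_{ij}| ≤
# |ι|·κ_e·2√m·√m·e^{r/n}·ℓ/n` from the LATTICE-LIPSCHITZ size `‖A_μ(x) − A_μ(x − e_μ)‖ ≤ ℓ` ((3.35)'s second member gives `ℓ ≤ r/n`), hence the divergence letter `n²λ = O(r)` of the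
# Leibniz route (dag-n15-c g23, n15-c∕226; HOME HANDOFF «g24 BRICKS», brick C)

Cell `pub-ymgap`, seat `pub-ymgap-dag-n15-c` (generation g23; R134 (a), s1; HUMAN RULING D-0062; chair R424 venue).  `bears_on: R4∕N15 · K3⁸ SpineGivenEndpointR13SepCoPHV
(stmt-QuantumFields-27366)`; filed `--supports stmt-QuantumFields-27366 --as helper` — COUNT-NEUTRAL.  Theorems only; 0 `sorry`.  Imports BY NAME n15-c∕218 (context: `cvT₀`, the datum
`e^{A/n}`), `CurvedSpecies.uN_abs_coordMat_conj_sub_conj_entry_le_op` (entry letter of a difference of two transporters), `MatrixSpecies.norm_exp_sub_exp_le` (Duhamel–Lipschitz),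
`CurvedSpecies.exp_smul_unitary_of_conjTranspose`.  Nothing in the tree is modified.

WHY.  The Leibniz route to the covariant gradient row (n15-c∕224–225) needs, besides the size letter `|T − 1| ≲ κ r/n` (n15-c∕218 `tLetter_rows`), the LIPSCHITZ letter of `T` along its own
direction: `W = n(1 − T)` has lattice divergence `div_n W` with letter `(d+1)·n·(nλ)` (n15-c∕225 `rows_bDiv_le`), and `λ ≲ κ·e^{r/n}·ℓ/n` with `ℓ` the lattice-Lipschitz size of `A` — so
`n²λ ≲ κ·e^{r/n}·nℓ ≤ κ·e^{r/n}·r` when `ℓ ≤ r/n` ([Balaban1985BackgroundPropagators] (3.35), second member: `|∇^η A| ≤ r`): the divergence letter is `O(r)`, which is what makes the CZ-free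
bootstrap close.
* ★★ `tLetter_lip_entry`, ★★ `tLetter_lip_rows`, `tLetter_div` (the letter of `div_n (n(1 − T))` is `≤ (d+1)·|ι|κ_e 2√m√m·e^{r/n}·(n·ℓ)`).

HONEST FRAMING ∕ LIMITS.  Real-analysis bookkeeping; MODEL transporters (site∕bond data, no B0 holonomies); NOT [Balaban1985BackgroundPropagators] Lemma 3.3 as printed; NE2⁺ NOT PRINTED; N15 of
record untouched (DISCHARGED AS CONSUMED, p687738); counts UNMOVED (typed 28∕28 · discharged 8∕27); one finite 𝕋⁴ at fixed ε per index — NOT infinite volume ∕ OS ∕ mass gap ∕ Clay.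
-/

noncomputable section

open scoped BigOperators Matrix

namespace Summit.QuantumFields.YangMills.BalabanUVNodes.N15.Gluing

open Literature.MathematicalPhysics.QuantumFieldTheory.Balaban1983to89
open Literature.MathematicalPhysics.QuantumFieldTheory.Balaban1983to89.B5Prop11Plancherel (Tor fine unitVec)
open Summit.QuantumFields.YangMills.BalabanUVNodes.N15.MatrixSpecies (basisConst basisConst_nonneg norm_exp_sub_exp_le)
open Summit.QuantumFields.YangMills.BalabanUVNodes.N15.CurvedSpecies (exp_smul_unitary_of_conjTranspose uN_abs_coordMat_conj_sub_conj_entry_le_op)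

variable {d : ℕ}

section Lip

open scoped Matrix.Norms.L2Operator

variable (M : Fin (d + 1) → ℕ) [∀ μ, NeZero (M μ)] (n : ℕ) [NeZero n] {ι : Type} [Fintype ι] [DecidableEq ι]
  {mm : Type} [Fintype mm] [DecidableEq mm] (e : Matrix mm mm ℂ ≃L[ℝ] (ι → ℝ))

/-- ★★ **THE LIPSCHITZ ENTRY LETTER**: `|(T_μ(z) − T_μ(z − e_μ))_{ij}| ≤ κ_e·2√m·(√m·(e^{r/n}·(ℓ/n)))` for `T = cvT₀ e (e^{A/n})`, `A` skew with `‖A‖ ≤ r` and `‖A_μ(z, μ) − A_μ(z − e_μ, μ)‖ ≤ ℓ`.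
[cite: Balaban1985BackgroundPropagators, (3.35) p.396 (the class: |A|, |∇A| small), (3.50) p.400 (shape)] -/
theorem tLetter_lip_entry {A : Fin (d + 1) → Tor (fine n M) × Fin (d + 1) → Matrix mm mm ℂ} (hAs : ∀ μ p, (A μ p)ᴴ = -A μ p) {r ℓ : ℝ} (hA : ∀ μ p, ‖A μ p‖ ≤ r)
    (hℓ : ∀ μ (z : Tor (fine n M)), ‖A μ (z, μ) - A μ (z - unitVec (fine n M) μ, μ)‖ ≤ ℓ) (μ : Fin (d + 1)) (z : Tor (fine n M)) (i j : ι) :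
    |((cvT₀ e (fun μ p => NormedSpace.exp ((((n : ℕ) : ℝ))⁻¹ • A μ p))) μ z - (cvT₀ e (fun μ p => NormedSpace.exp ((((n : ℕ) : ℝ))⁻¹ • A μ p))) μ (z - unitVec (fine n M) μ)) i j| ≤
      @basisConst ι _ (Matrix mm mm ℂ) Matrix.frobeniusNormedAddCommGroup Matrix.frobeniusNormedSpace e * (2 * Real.sqrt (Fintype.card mm)) * (Real.sqrt (Fintype.card mm) * (Real.exp ((((n : ℕ) : ℝ))⁻¹ * r) * ((((n : ℕ) : ℝ))⁻¹ * ℓ))) := by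
  have hη : (0 : ℝ) ≤ (((n : ℕ) : ℝ))⁻¹ := by positivity
  have hU : ∀ p, (NormedSpace.exp ((((n : ℕ) : ℝ))⁻¹ • A μ p))ᴴ * NormedSpace.exp ((((n : ℕ) : ℝ))⁻¹ • A μ p) = 1 := fun p => exp_smul_unitary_of_conjTranspose (hAs μ p) _
  have hκ := @basisConst_nonneg ι _ (Matrix mm mm ℂ) Matrix.frobeniusNormedAddCommGroup Matrix.frobeniusNormedSpace e
  have h1 := uN_abs_coordMat_conj_sub_conj_entry_le_op e (hU (z - unitVec (fine n M) μ, μ)) (hU (z, μ)) i j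
  have hnA : ∀ p, ‖(((n : ℕ) : ℝ))⁻¹ • A μ p‖ ≤ (((n : ℕ) : ℝ))⁻¹ * r := fun p => by
    rw [norm_smul, Real.norm_of_nonneg hη]; exact mul_le_mul_of_nonneg_left (hA μ p) hη
  have h2 : ‖NormedSpace.exp ((((n : ℕ) : ℝ))⁻¹ • A μ (z, μ)) - NormedSpace.exp ((((n : ℕ) : ℝ))⁻¹ • A μ (z - unitVec (fine n M) μ, μ))‖ ≤
      Real.exp ((((n : ℕ) : ℝ))⁻¹ * r) * ((((n : ℕ) : ℝ))⁻¹ * ℓ) := by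
    refine (norm_exp_sub_exp_le (hnA (z, μ)) (hnA (z - unitVec (fine n M) μ, μ))).trans ?_
    rw [← smul_sub, norm_smul, Real.norm_of_nonneg hη]
    exact mul_le_mul_of_nonneg_left (mul_le_mul_of_nonneg_left (hℓ μ z) hη) (Real.exp_nonneg _)
  refine h1.trans ?_
  gcongr

/-- ★★ **THE LIPSCHITZ ROW LETTER**: `Σ_j |(T_μ(z) − T_μ(z − e_μ))_{ij}| ≤ |ι|·κ_e·2√m·(√m·(e^{r/n}·(ℓ/n)))`. [cite: Balaban1985BackgroundPropagators, (3.35) p.396, (3.50) p.400 (shapes)] -/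
theorem tLetter_lip_rows {A : Fin (d + 1) → Tor (fine n M) × Fin (d + 1) → Matrix mm mm ℂ} (hAs : ∀ μ p, (A μ p)ᴴ = -A μ p) {r ℓ : ℝ} (hA : ∀ μ p, ‖A μ p‖ ≤ r)
    (hℓ : ∀ μ (z : Tor (fine n M)), ‖A μ (z, μ) - A μ (z - unitVec (fine n M) μ, μ)‖ ≤ ℓ) (μ : Fin (d + 1)) (z : Tor (fine n M)) (i : ι) :
    ∑ j, |((cvT₀ e (fun μ p => NormedSpace.exp ((((n : ℕ) : ℝ))⁻¹ • A μ p))) μ z - (cvT₀ e (fun μ p => NormedSpace.exp ((((n : ℕ) : ℝ))⁻¹ • A μ p))) μ (z - unitVec (fine n M) μ)) i j| ≤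
      Fintype.card ι * (@basisConst ι _ (Matrix mm mm ℂ) Matrix.frobeniusNormedAddCommGroup Matrix.frobeniusNormedSpace e * (2 * Real.sqrt (Fintype.card mm)) * (Real.sqrt (Fintype.card mm) * (Real.exp ((((n : ℕ) : ℝ))⁻¹ * r) * ((((n : ℕ) : ℝ))⁻¹ * ℓ)))) := by
  calc _ ≤ ∑ _j : ι, @basisConst ι _ (Matrix mm mm ℂ) Matrix.frobeniusNormedAddCommGroup Matrix.frobeniusNormedSpace e * (2 * Real.sqrt (Fintype.card mm)) * (Real.sqrt (Fintype.card mm) * (Real.exp ((((n : ℕ) : ℝ))⁻¹ * r) * ((((n : ℕ) : ℝ))⁻¹ * ℓ))) :=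
        Finset.sum_le_sum fun j _ => tLetter_lip_entry M n e hAs hA hℓ μ z i j
    _ = _ := by rw [Finset.sum_const, Finset.card_univ, nsmul_eq_mul]

/-- **THE DIVERGENCE LETTER OF `W = n(1 − T)`**: `Σ_j|(W_μ(z − e_μ) − W_μ(z))_{ij}| ≤ |ι|κ_e2√m√m·e^{r/n}·ℓ` (the `n` of `W` cancels the `1/n` of the Lipschitz letter) — with (3.35)'s `ℓ ≤ r/n`
this is `O(r/n)`, and n15-c∕225 `rows_bDiv_le` turns it into the `O(r)` letter `(d+1)·|ι|κ_e2√m√m·e^{r/n}·(nℓ)` of `div_n W`. [cite: Balaban1985BackgroundPropagators, (3.35) p.396 (shape)] -/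
theorem tLetter_div {A : Fin (d + 1) → Tor (fine n M) × Fin (d + 1) → Matrix mm mm ℂ} (hAs : ∀ μ p, (A μ p)ᴴ = -A μ p) {r ℓ : ℝ} (hA : ∀ μ p, ‖A μ p‖ ≤ r)
    (hℓ : ∀ μ (z : Tor (fine n M)), ‖A μ (z, μ) - A μ (z - unitVec (fine n M) μ, μ)‖ ≤ ℓ) (μ : Fin (d + 1)) (z : Tor (fine n M)) (i : ι) :
    ∑ j, |((fun ν x => (n : ℝ) • ((1 : Matrix ι ι ℝ) - (cvT₀ e (fun μ p => NormedSpace.exp ((((n : ℕ) : ℝ))⁻¹ • A μ p))) ν x)) μ (z - unitVec (fine n M) μ) - (fun ν x => (n : ℝ) • ((1 : Matrix ι ι ℝ) - (cvT₀ e (fun μ p => NormedSpace.exp ((((n : ℕ) : ℝ))⁻¹ • A μ p))) ν x)) μ z) i j| ≤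
      Fintype.card ι * (@basisConst ι _ (Matrix mm mm ℂ) Matrix.frobeniusNormedAddCommGroup Matrix.frobeniusNormedSpace e * (2 * Real.sqrt (Fintype.card mm)) * (Real.sqrt (Fintype.card mm) * (Real.exp ((((n : ℕ) : ℝ))⁻¹ * r) * ℓ))) := by
  have hn : (0 : ℝ) < (n : ℝ) := Nat.cast_pos.mpr (Nat.pos_of_ne_zero (NeZero.ne n))
  have key := tLetter_lip_rows M n e hAs hA hℓ μ z i
  have hrew : ∀ j, |((fun ν x => (n : ℝ) • ((1 : Matrix ι ι ℝ) - (cvT₀ e (fun μ p => NormedSpace.exp ((((n : ℕ) : ℝ))⁻¹ • A μ p))) ν x)) μ (z - unitVec (fine n M) μ) - (fun ν x => (n : ℝ) • ((1 : Matrix ι ι ℝ) - (cvT₀ e (fun μ p => NormedSpace.exp ((((n : ℕ) : ℝ))⁻¹ • A μ p))) ν x)) μ z) i j| =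
      (n : ℝ) * |((cvT₀ e (fun μ p => NormedSpace.exp ((((n : ℕ) : ℝ))⁻¹ • A μ p))) μ z - (cvT₀ e (fun μ p => NormedSpace.exp ((((n : ℕ) : ℝ))⁻¹ • A μ p))) μ (z - unitVec (fine n M) μ)) i j| := by
    intro j
    rw [← smul_sub, Matrix.smul_apply, smul_eq_mul, abs_mul, abs_of_pos hn, sub_sub_sub_cancel_left]
  simp_rw [hrew]
  rw [← Finset.mul_sum]
  refine (mul_le_mul_of_nonneg_left key hn.le).trans (le_of_eq ?_)
  have hn0 : (n : ℝ) ≠ 0 := hn.ne'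
  field_simp

end Lip

end Summit.QuantumFields.YangMills.BalabanUVNodes.N15.Gluing

end
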